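import Summits.QuantumFields.YangMills.Theorems.AllWindowsColdBoxBoxHighLineTiltUMoments
import Summits.QuantumFields.YangMills.Theorems.AllWindowsColdBoxBoxHighLineTiltCum5Sizes

/-!
# U5-L3-concrete STAGE 2, CONCLUSION — the fifth tilted cumulant `κ₅,t(c_x, c_y; tiltU)` over `μ_D` with the `U`-SLOTS DISCHARGED
# (`Cruxes/BoxWindowHighSU2213/U5-BLOCKERS.md` §2 L3 «f‴ size»; LINE-20 U5 ⟨stmt-QuantumFields-24336⟩)

Width seat `ym-line-sfw-p2-w5` (prover-ym-line-sfw-p2-w5-g24-0).  fcl-p3 g26's ✓`GaussNormalForm.abs_tiltCum5_muD_le_of_sizes` (STAGE 1) bounds `κ₅,t` by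
the three restricted-Gaussian moments `RU_k ≥ E₀[1_D(tiltU − b)^k]`, `k = 2, 4, 6`, of ONE centring `b`; this seat's ✓`gaussAvg_sfInd_mul_tiltU_sub_pow_even_le`
(`…TiltUMoments`) supplies them.  Here:

* ★ `gaussAvg_sfInd_mul_tiltU_sub_pow_two_four_six_le` — the `k = 1, 2, 3` instances in the slots' exact `^2 / ^4 / ^6` shape, one `C`, one `m`, one `b`:
  `E₀[1_D(U − b)^{2k}] ≤ C(1+log H)^m·R_k`, `R_k = (H⁴/β)^k + (βH⁴s⁵)^{2k} + (H⁶s³)^{2k} + (H⁴s⁴)^{2k}` (`H ≥ 1`, `β ≥ H⁴`, `0 ≤ s ≤ 1`, `s·H² ≤ c₀`);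
* ★★ `abs_tiltCum5_muD_le_of_tiltU` — **κ₅ with the `U`-slots discharged**: for `H ≥ 1`, `β ≥ H⁴`, `0 < s ≤ 1`, `s·H² ≤ c₀`, `sup_D|tiltU| ≤ 1`, `E₀[1_D] ≥ 1/2`,
  all `x, y`, `t ∈ [0,1]`:
  `|κ₅,t| ≤ C·(1+log H)^m·((1+log H)²/β² + s³/(β√β))·(√R₃ + √R₁·√R₂ + R₁·√R₁)`;
* ★★ `abs_tiltCum5_muD_le_dominant` — in the DOMINANT REGIME `βH⁴s⁵, H⁶s³, H⁴s⁴ ≤ H²/√β` (true in U5 letters `s = β^{κ₃−1/2}`, `H = β^θ`, `θ < 1/10`,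
  `κ₃ < (1/2−4θ)/3`): `|κ₅,t| ≤ 14·C·(1+log H)^m·((1+log H)²/β² + s³/(β√β))·H⁶/(β√β)` — i.e. `κ₅ ≲ (1+log H)^{m+2}·H⁶·β^{−7/2}`, U5-BLOCKERS L3's size of `f‴`,
  the `hK` input of fcl-p3's ✓`tiltThirdOrder` for the U5 assembler (the two remaining hypotheses `sup_D|tiltU| ≤ 1`, `E₀[1_D] ≥ 1/2` are ✓ by name in the
  S5 window — ✓`TiltSup.exists_forall_abs_tiltU_le_one`, ✓`GaussTail.exists_beta0_half_le_gaussAvg_sfInd` — and are the assembler's in U5's).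

Tree only; no definitions; standard axioms.  HONEST LABEL: U5 prep, helper-grade; U5 ⟨24336⟩ UNSTAFFED/OPEN, ⟨24004⟩ OPEN; route AllWindowsColdBox DRAFT; no crux,
rung or summit is proved; **the Yang–Mills mass gap is NOT proved by this file; no summit is proved by a line.**
-/

set_option autoImplicit false

noncomputable section

open MeasureTheory Set Real
open Literature.Probability.LatticeModels (Site)

namespace Summit.QuantumFields.YangMills.Theorems.AllWindowsColdBoxBoxHighLine

namespace GaussNormalForm

/-! ## §1 The three slots -/

/-- ★ **The three slots `RU₂, RU₄, RU₆` of ✓`abs_tiltCum5_muD_le_of_sizes`, ONE common `b`, one `C`, one `m`** (the `k = 1, 2, 3` instances of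
✓`gaussAvg_sfInd_mul_tiltU_sub_pow_even_le`, exponents spelled `^2`, `^4`, `^6`). -/
theorem gaussAvg_sfInd_mul_tiltU_sub_pow_two_four_six_le :
    ∃ C : ℝ, ∃ m : ℕ, ∃ c₀ : ℝ, 0 < c₀ ∧ 0 ≤ C ∧
      ∀ H : ℕ, 1 ≤ H → ∀ β : ℝ, (H : ℝ) ^ 4 ≤ β → ∀ s : ℝ, 0 ≤ s → s ≤ 1 → s * (H : ℝ) ^ 2 ≤ c₀ →
        ∃ b : ℝ,
          gaussAvg β H (fun a => sfInd H s a * (tiltU β H a - b) ^ 2) ≤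
              C * (1 + Real.log H) ^ m * ((H : ℝ) ^ 4 / β + (β * (H : ℝ) ^ 4 * s ^ 5) ^ 2 + ((H : ℝ) ^ 6 * s ^ 3) ^ 2 + ((H : ℝ) ^ 4 * s ^ 4) ^ 2) ∧
          gaussAvg β H (fun a => sfInd H s a * (tiltU β H a - b) ^ 4) ≤
              C * (1 + Real.log H) ^ m * (((H : ℝ) ^ 4 / β) ^ 2 + (β * (H : ℝ) ^ 4 * s ^ 5) ^ 4 + ((H : ℝ) ^ 6 * s ^ 3) ^ 4 + ((H : ℝ) ^ 4 * s ^ 4) ^ 4) ∧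
          gaussAvg β H (fun a => sfInd H s a * (tiltU β H a - b) ^ 6) ≤
              C * (1 + Real.log H) ^ m * (((H : ℝ) ^ 4 / β) ^ 3 + (β * (H : ℝ) ^ 4 * s ^ 5) ^ 6 + ((H : ℝ) ^ 6 * s ^ 3) ^ 6 + ((H : ℝ) ^ 4 * s ^ 4) ^ 6) := by
  obtain ⟨C, m, c₀, hc₀, hC0, h⟩ := gaussAvg_sfInd_mul_tiltU_sub_pow_even_le
  refine ⟨max (C 1) (max (C 2) (C 3)), max (m 1) (max (m 2) (m 3)), c₀, hc₀, (hC0 1).trans (le_max_left _ _), fun H hH β hβ s hs0 hs1 hsH => ?_⟩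
  obtain ⟨b, hb⟩ := h H hH β hβ s hs0 hs1 hsH
  have hH1 : (1 : ℝ) ≤ H := by exact_mod_cast hH
  have hβpos : 0 < β := lt_of_lt_of_le (by positivity) hβ
  have hL1 : 1 ≤ 1 + Real.log (H : ℝ) := by have := Real.log_nonneg hH1; linarith
  -- `C k · L^{m k} · R ≤ Cmax · L^{mmax} · R`
  have hup : ∀ k : ℕ, k = 1 ∨ k = 2 ∨ k = 3 → ∀ R : ℝ, 0 ≤ R →
      C k * (1 + Real.log (H : ℝ)) ^ (m k) * R ≤ max (C 1) (max (C 2) (C 3)) * (1 + Real.log (H : ℝ)) ^ (max (m 1) (max (m 2) (m 3))) * R := by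
    intro k hk R hR
    have hCk : C k ≤ max (C 1) (max (C 2) (C 3)) := by
      rcases hk with rfl | rfl | rfl
      · exact le_max_left _ _
      · exact (le_max_left _ _).trans (le_max_right _ _)
      · exact (le_max_right _ _).trans (le_max_right _ _)
    have hmk : m k ≤ max (m 1) (max (m 2) (m 3)) := by
      rcases hk with rfl | rfl | rfl
      · exact le_max_left _ _
      · exact (le_max_left _ _).trans (le_max_right _ _)
      · exact (le_max_right _ _).trans (le_max_right _ _)
    have hLk : (1 + Real.log (H : ℝ)) ^ (m k) ≤ (1 + Real.log (H : ℝ)) ^ (max (m 1) (max (m 2) (m 3))) := pow_le_pow_right₀ hL1 hmk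
    exact mul_le_mul_of_nonneg_right (mul_le_mul hCk hLk (by positivity) ((hC0 k).trans hCk)) hR
  refine ⟨b, ?_, ?_, ?_⟩
  · have h1 := hb 1 le_rfl
    simp only [Nat.mul_one, pow_one] at h1
    exact h1.trans (hup 1 (Or.inl rfl) _ (by positivity))
  · have h2 := hb 2 (by norm_num)
    simp only [show 2 * 2 = 4 from rfl] at h2
    exact h2.trans (hup 2 (Or.inr (Or.inl rfl)) _ (by positivity))
  · have h3 := hb 3 (by norm_num)
    simp only [show 2 * 3 = 6 from rfl] at h3
    exact h3.trans (hup 3 (Or.inr (Or.inr rfl)) _ (by positivity))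

/-! ## §2 `κ₅,t` with the `U`-slots discharged -/

/-- Pure-real collapse of the three-slot bound: with `RU_k = K·R_k` (`K ≥ 0`),
`a·√RU₃ + c·(√RU₁·√RU₂) + a·(RU₁·√RU₁) ≤ (1 + K)²·(a·√R₃ + c·(√R₁·√R₂) + a·(R₁·√R₁))` for `a, c, R₁ ≥ 0`. -/
theorem k5_slots_collapse {K a c R₁ R₂ R₃ : ℝ} (hK : 0 ≤ K) (ha : 0 ≤ a) (hc : 0 ≤ c) (h1 : 0 ≤ R₁) :
    a * Real.sqrt (K * R₃) + c * (Real.sqrt (K * R₁) * Real.sqrt (K * R₂)) + a * (K * R₁ * Real.sqrt (K * R₁)) ≤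
      (1 + K) ^ 2 * (a * Real.sqrt R₃ + c * (Real.sqrt R₁ * Real.sqrt R₂) + a * (R₁ * Real.sqrt R₁)) := by
  have hsK : Real.sqrt K ≤ 1 + K := by
    have h := Real.sqrt_le_sqrt (show K ≤ (1 + K) ^ 2 by nlinarith)
    rwa [Real.sqrt_sq (by linarith)] at h
  have hK1 : K ≤ (1 + K) ^ 2 := by nlinarith
  have hsK2 : Real.sqrt K ≤ (1 + K) ^ 2 := hsK.trans (by nlinarith)
  have hKsK : K * Real.sqrt K ≤ (1 + K) ^ 2 := by
    calc K * Real.sqrt K ≤ (1 + K) * (1 + K) := mul_le_mul (by linarith) hsK (Real.sqrt_nonneg _) (by linarith)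
      _ = (1 + K) ^ 2 := by ring
  rw [Real.sqrt_mul hK, Real.sqrt_mul hK, Real.sqrt_mul hK]
  have e1 : a * (Real.sqrt K * Real.sqrt R₃) = Real.sqrt K * (a * Real.sqrt R₃) := by ring
  have e2 : c * (Real.sqrt K * Real.sqrt R₁ * (Real.sqrt K * Real.sqrt R₂)) = (Real.sqrt K * Real.sqrt K) * (c * (Real.sqrt R₁ * Real.sqrt R₂)) := by ring
  have e3 : a * (K * R₁ * (Real.sqrt K * Real.sqrt R₁)) = (K * Real.sqrt K) * (a * (R₁ * Real.sqrt R₁)) := by ring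
  rw [e1, e2, e3, Real.mul_self_sqrt hK]
  have t1 : Real.sqrt K * (a * Real.sqrt R₃) ≤ (1 + K) ^ 2 * (a * Real.sqrt R₃) :=
    mul_le_mul_of_nonneg_right hsK2 (mul_nonneg ha (Real.sqrt_nonneg _))
  have t2 : K * (c * (Real.sqrt R₁ * Real.sqrt R₂)) ≤ (1 + K) ^ 2 * (c * (Real.sqrt R₁ * Real.sqrt R₂)) :=
    mul_le_mul_of_nonneg_right hK1 (mul_nonneg hc (mul_nonneg (Real.sqrt_nonneg _) (Real.sqrt_nonneg _)))
  have t3 : K * Real.sqrt K * (a * (R₁ * Real.sqrt R₁)) ≤ (1 + K) ^ 2 * (a * (R₁ * Real.sqrt R₁)) :=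
    mul_le_mul_of_nonneg_right hKsK (mul_nonneg ha (mul_nonneg h1 (Real.sqrt_nonneg _)))
  linarith only [t1, t2, t3]

/-- ★★ **`κ₅,t(c_x, c_y; tiltU)` over `μ_D` with the `U`-slots DISCHARGED**: there are `C ≥ 0`, `m`, `c₀ > 0` such that for all `H ≥ 1`, `β ≥ H⁴`, `0 < s ≤ 1` with
`s·H² ≤ c₀`, `sup_D|tiltU| ≤ 1`, `E₀[1_D] ≥ 1/2`, all base points `x, y` and `t ∈ [0,1]`, with `R_k = (H⁴/β)^k + (βH⁴s⁵)^{2k} + (H⁶s³)^{2k} + (H⁴s⁴)^{2k}`: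
`|κ₅,t| ≤ C·(1+log H)^m·((1+log H)²/β² + s³/(β√β))·(√R₃ + √R₁·√R₂ + R₁·√R₁)`. -/
theorem abs_tiltCum5_muD_le_of_tiltU : ∃ C : ℝ, ∃ m : ℕ, ∃ c₀ : ℝ, 0 < c₀ ∧ 0 ≤ C ∧
    ∀ H : ℕ, 1 ≤ H → ∀ β : ℝ, (H : ℝ) ^ 4 ≤ β → ∀ s : ℝ, 0 < s → s ≤ 1 → s * (H : ℝ) ^ 2 ≤ c₀ →
    (∀ a ∈ smallField H s, |tiltU β H a| ≤ 1) → 1 / 2 ≤ gaussAvg β H (sfInd H s) →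
    ∀ (x y : Site 4), ∀ t ∈ Set.Icc (0 : ℝ) 1,
      |Tilt.tiltCum5 ((volume.restrict (smallField H s)).withDensity fun a => ENNReal.ofReal (gaussWeight β H a))
          (tiltU β H) t (chartPlaqCost H x 1 2) (chartPlaqCost H y 1 2)| ≤
        C * (1 + Real.log H) ^ m * (((1 + Real.log H) ^ 2 / β ^ 2 + s ^ 3 / (β * Real.sqrt β)) *
          (Real.sqrt (((H : ℝ) ^ 4 / β) ^ 3 + (β * (H : ℝ) ^ 4 * s ^ 5) ^ 6 + ((H : ℝ) ^ 6 * s ^ 3) ^ 6 + ((H : ℝ) ^ 4 * s ^ 4) ^ 6) +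
            Real.sqrt ((H : ℝ) ^ 4 / β + (β * (H : ℝ) ^ 4 * s ^ 5) ^ 2 + ((H : ℝ) ^ 6 * s ^ 3) ^ 2 + ((H : ℝ) ^ 4 * s ^ 4) ^ 2) *
              Real.sqrt (((H : ℝ) ^ 4 / β) ^ 2 + (β * (H : ℝ) ^ 4 * s ^ 5) ^ 4 + ((H : ℝ) ^ 6 * s ^ 3) ^ 4 + ((H : ℝ) ^ 4 * s ^ 4) ^ 4) +
            ((H : ℝ) ^ 4 / β + (β * (H : ℝ) ^ 4 * s ^ 5) ^ 2 + ((H : ℝ) ^ 6 * s ^ 3) ^ 2 + ((H : ℝ) ^ 4 * s ^ 4) ^ 2) *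
              Real.sqrt ((H : ℝ) ^ 4 / β + (β * (H : ℝ) ^ 4 * s ^ 5) ^ 2 + ((H : ℝ) ^ 6 * s ^ 3) ^ 2 + ((H : ℝ) ^ 4 * s ^ 4) ^ 2))) := by
  obtain ⟨C₅, hC₅0, h5⟩ := abs_tiltCum5_muD_le_of_sizes
  obtain ⟨CU, m, c₀, hc₀, hCU0, hU⟩ := gaussAvg_sfInd_mul_tiltU_sub_pow_two_four_six_le
  refine ⟨C₅ * (1 + CU) ^ 2, 2 * m, c₀, hc₀, by positivity, fun H hH β hβ s hs0 hs1 hsH hU1 hD x y t ht => ?_⟩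
  have hH1 : (1 : ℝ) ≤ H := by exact_mod_cast hH
  have hβ1 : 1 ≤ β := le_trans (one_le_pow₀ hH1) hβ
  have hβpos : 0 < β := lt_of_lt_of_le one_pos hβ1
  obtain ⟨b, hb2, hb4, hb6⟩ := hU H hH β hβ s hs0.le hs1 hsH
  -- opaque abbreviations
  obtain ⟨L, hL⟩ : ∃ L : ℝ, L = 1 + Real.log (H : ℝ) := ⟨_, rfl⟩
  have hL1 : 1 ≤ L := by rw [hL]; have := Real.log_nonneg hH1; linarith
  have hL0 : 0 ≤ L := zero_le_one.trans hL1
  obtain ⟨R₁, hR₁⟩ : ∃ R : ℝ, R = (H : ℝ) ^ 4 / β + (β * (H : ℝ) ^ 4 * s ^ 5) ^ 2 + ((H : ℝ) ^ 6 * s ^ 3) ^ 2 + ((H : ℝ) ^ 4 * s ^ 4) ^ 2 := ⟨_, rfl⟩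
  obtain ⟨R₂, hR₂⟩ : ∃ R : ℝ, R = ((H : ℝ) ^ 4 / β) ^ 2 + (β * (H : ℝ) ^ 4 * s ^ 5) ^ 4 + ((H : ℝ) ^ 6 * s ^ 3) ^ 4 + ((H : ℝ) ^ 4 * s ^ 4) ^ 4 :=
    ⟨_, rfl⟩
  obtain ⟨R₃, hR₃⟩ : ∃ R : ℝ, R = ((H : ℝ) ^ 4 / β) ^ 3 + (β * (H : ℝ) ^ 4 * s ^ 5) ^ 6 + ((H : ℝ) ^ 6 * s ^ 3) ^ 6 + ((H : ℝ) ^ 4 * s ^ 4) ^ 6 :=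
    ⟨_, rfl⟩
  have hR₁0 : 0 ≤ R₁ := by rw [hR₁]; positivity
  obtain ⟨K, hK⟩ : ∃ K : ℝ, K = CU * L ^ m := ⟨_, rfl⟩
  have hK0 : 0 ≤ K := by rw [hK]; exact mul_nonneg hCU0 (pow_nonneg hL0 _)
  rw [← hL, ← hR₁] at hb2
  rw [← hL, ← hR₂] at hb4
  rw [← hL, ← hR₃] at hb6
  rw [← hL, ← hR₁, ← hR₂, ← hR₃]
  rw [← hK] at hb2 hb4 hb6
  have h := h5 H hH β hβ1 s hs0 hs1 hU1 hD b (K * R₁) (K * R₂) (K * R₃) (mul_nonneg hK0 hR₁0) (mul_nonneg hK0 (by rw [hR₂]; positivity))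
    (mul_nonneg hK0 (by rw [hR₃]; positivity)) hb2 hb4 hb6 x y t ht
  rw [← hL] at h
  have hA0 : 0 ≤ L ^ 2 / β ^ 2 := by positivity
  have hSg0 : 0 ≤ s ^ 3 / (β * Real.sqrt β) := by positivity
  have hcoll := k5_slots_collapse (R₂ := R₂) (R₃ := R₃) (a := L ^ 2 / β ^ 2 + s ^ 3 / (β * Real.sqrt β)) (c := L ^ 2 / β ^ 2) hK0
    (add_nonneg hA0 hSg0) hA0 hR₁0
  -- `(1 + K)² ≤ (1 + CU)²·L^{2m}`
  have hKL : (1 + K) ^ 2 ≤ (1 + CU) ^ 2 * L ^ (2 * m) := by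
    have hLm1 : 1 ≤ L ^ m := one_le_pow₀ hL1
    have h1 : 1 + K ≤ (1 + CU) * L ^ m := by rw [hK]; nlinarith only [hLm1, hCU0]
    calc (1 + K) ^ 2 ≤ ((1 + CU) * L ^ m) ^ 2 := pow_le_pow_left₀ (by linarith only [hK0]) h1 2
      _ = (1 + CU) ^ 2 * L ^ (2 * m) := by ring
  -- opaque square roots
  obtain ⟨u, hu⟩ : ∃ u : ℝ, u = Real.sqrt R₁ := ⟨_, rfl⟩
  obtain ⟨v, hv⟩ : ∃ v : ℝ, v = Real.sqrt R₂ := ⟨_, rfl⟩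
  obtain ⟨w, hw⟩ : ∃ w : ℝ, w = Real.sqrt R₃ := ⟨_, rfl⟩
  have hu0 : 0 ≤ u := by rw [hu]; exact Real.sqrt_nonneg _
  have hv0 : 0 ≤ v := by rw [hv]; exact Real.sqrt_nonneg _
  have hw0 : 0 ≤ w := by rw [hw]; exact Real.sqrt_nonneg _
  rw [← hu, ← hv, ← hw] at hcoll ⊢
  obtain ⟨a, ha⟩ : ∃ a : ℝ, a = L ^ 2 / β ^ 2 + s ^ 3 / (β * Real.sqrt β) := ⟨_, rfl⟩
  obtain ⟨c, hc⟩ : ∃ c : ℝ, c = L ^ 2 / β ^ 2 := ⟨_, rfl⟩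
  have ha0 : 0 ≤ a := by rw [ha]; exact add_nonneg hA0 hSg0
  have hca : c ≤ a := by rw [hc, ha]; exact le_add_of_nonneg_right hSg0
  have hc0 : 0 ≤ c := by rw [hc]; exact hA0
  rw [← ha] at h hcoll ⊢
  rw [← hc] at h hcoll
  have hB0 : 0 ≤ a * w + c * (u * v) + a * (R₁ * u) := by positivity
  have hx : c * (u * v) ≤ a * (u * v) := mul_le_mul_of_nonneg_right hca (mul_nonneg hu0 hv0)
  calc |Tilt.tiltCum5 ((volume.restrict (smallField H s)).withDensity fun a => ENNReal.ofReal (gaussWeight β H a))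
          (tiltU β H) t (chartPlaqCost H x 1 2) (chartPlaqCost H y 1 2)|
      ≤ C₅ * (a * Real.sqrt (K * R₃) + c * (Real.sqrt (K * R₁) * Real.sqrt (K * R₂)) + a * (K * R₁ * Real.sqrt (K * R₁))) := h
    _ ≤ C₅ * ((1 + K) ^ 2 * (a * w + c * (u * v) + a * (R₁ * u))) := mul_le_mul_of_nonneg_left hcoll hC₅0
    _ ≤ C₅ * ((1 + CU) ^ 2 * L ^ (2 * m) * (a * w + c * (u * v) + a * (R₁ * u))) :=
        mul_le_mul_of_nonneg_left (mul_le_mul_of_nonneg_right hKL hB0) hC₅0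
    _ ≤ C₅ * ((1 + CU) ^ 2 * L ^ (2 * m) * (a * (w + u * v + R₁ * u))) := by
        have hc0' : 0 ≤ (1 + CU) ^ 2 * L ^ (2 * m) := by positivity
        have : a * w + c * (u * v) + a * (R₁ * u) ≤ a * (w + u * v + R₁ * u) := by nlinarith only [hx]
        exact mul_le_mul_of_nonneg_left (mul_le_mul_of_nonneg_left this hc0') hC₅0
    _ = C₅ * (1 + CU) ^ 2 * L ^ (2 * m) * (a * (w + u * v + R₁ * u)) := by ring

/-- ★★ **`κ₅,t` in the DOMINANT regime** (`βH⁴s⁵ ≤ H²/√β`, `H⁶s³ ≤ H²/√β`, `H⁴s⁴ ≤ H²/√β` — then each `R_k ≤ 4(H²/√β)^{2k}`):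
`|κ₅,t| ≤ 14·C·(1+log H)^m·((1+log H)²/β² + s³/(β√β))·H⁶/(β√β)`, i.e. `κ₅ ≲ (1+log H)^{m+2}·H⁶·β^{−7/2}` (U5-BLOCKERS L3's size of `f‴`). -/
theorem abs_tiltCum5_muD_le_dominant : ∃ C : ℝ, ∃ m : ℕ, ∃ c₀ : ℝ, 0 < c₀ ∧ 0 ≤ C ∧
    ∀ H : ℕ, 1 ≤ H → ∀ β : ℝ, (H : ℝ) ^ 4 ≤ β → ∀ s : ℝ, 0 < s → s ≤ 1 → s * (H : ℝ) ^ 2 ≤ c₀ →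
    β * (H : ℝ) ^ 4 * s ^ 5 ≤ (H : ℝ) ^ 2 / Real.sqrt β → (H : ℝ) ^ 6 * s ^ 3 ≤ (H : ℝ) ^ 2 / Real.sqrt β → (H : ℝ) ^ 4 * s ^ 4 ≤ (H : ℝ) ^ 2 / Real.sqrt β →
    (∀ a ∈ smallField H s, |tiltU β H a| ≤ 1) → 1 / 2 ≤ gaussAvg β H (sfInd H s) →
    ∀ (x y : Site 4), ∀ t ∈ Set.Icc (0 : ℝ) 1,
      |Tilt.tiltCum5 ((volume.restrict (smallField H s)).withDensity fun a => ENNReal.ofReal (gaussWeight β H a))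
          (tiltU β H) t (chartPlaqCost H x 1 2) (chartPlaqCost H y 1 2)| ≤
        14 * C * (1 + Real.log H) ^ m * (((1 + Real.log H) ^ 2 / β ^ 2 + s ^ 3 / (β * Real.sqrt β)) * ((H : ℝ) ^ 6 / (β * Real.sqrt β))) := by
  obtain ⟨C, m, c₀, hc₀, hC0, h⟩ := abs_tiltCum5_muD_le_of_tiltU
  refine ⟨C, m, c₀, hc₀, hC0, fun H hH β hβ s hs0 hs1 hsH hd1 hd2 hd3 hU1 hD x y t ht => ?_⟩
  have hH1 : (1 : ℝ) ≤ H := by exact_mod_cast hH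
  have hβ1 : 1 ≤ β := le_trans (one_le_pow₀ hH1) hβ
  have hβpos : 0 < β := lt_of_lt_of_le one_pos hβ1
  have hh := h H hH β hβ s hs0 hs1 hsH hU1 hD x y t ht
  -- `ρ = H²/√β`: `ρ² = H⁴/β`, `ρ³ = H⁶/(β√β)`
  obtain ⟨ρ, hρ⟩ : ∃ r : ℝ, r = (H : ℝ) ^ 2 / Real.sqrt β := ⟨_, rfl⟩
  have hρ0 : 0 ≤ ρ := by rw [hρ]; positivity
  have hρ2 : (H : ℝ) ^ 4 / β = ρ ^ 2 := by
    rw [hρ, div_pow, Real.sq_sqrt hβpos.le]; ring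
  have hρ3 : (H : ℝ) ^ 6 / (β * Real.sqrt β) = ρ ^ 3 := by
    have e3 : Real.sqrt β ^ 3 = β * Real.sqrt β := by
      rw [pow_succ, Real.sq_sqrt hβpos.le]
    rw [hρ, div_pow, e3]; ring
  rw [← hρ] at hd1 hd2 hd3
  have hb1 : 0 ≤ β * (H : ℝ) ^ 4 * s ^ 5 := by positivity
  have hb2 : 0 ≤ (H : ℝ) ^ 6 * s ^ 3 := by positivity
  have hb3 : 0 ≤ (H : ℝ) ^ 4 * s ^ 4 := by positivity
  -- `R_k ≤ 4(ρ²)^k`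
  have hRle : ∀ k : ℕ, ((H : ℝ) ^ 4 / β) ^ k + (β * (H : ℝ) ^ 4 * s ^ 5) ^ (2 * k) + ((H : ℝ) ^ 6 * s ^ 3) ^ (2 * k) +
      ((H : ℝ) ^ 4 * s ^ 4) ^ (2 * k) ≤ 4 * (ρ ^ 2) ^ k := by
    intro k
    have t1 : (β * (H : ℝ) ^ 4 * s ^ 5) ^ (2 * k) ≤ (ρ ^ 2) ^ k := by
      rw [pow_mul]; exact pow_le_pow_left₀ (sq_nonneg _) (pow_le_pow_left₀ hb1 hd1 2) k
    have t2 : ((H : ℝ) ^ 6 * s ^ 3) ^ (2 * k) ≤ (ρ ^ 2) ^ k := by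
      rw [pow_mul]; exact pow_le_pow_left₀ (sq_nonneg _) (pow_le_pow_left₀ hb2 hd2 2) k
    have t3 : ((H : ℝ) ^ 4 * s ^ 4) ^ (2 * k) ≤ (ρ ^ 2) ^ k := by
      rw [pow_mul]; exact pow_le_pow_left₀ (sq_nonneg _) (pow_le_pow_left₀ hb3 hd3 2) k
    rw [hρ2]
    linarith only [t1, t2, t3]
  have hR1 : (H : ℝ) ^ 4 / β + (β * (H : ℝ) ^ 4 * s ^ 5) ^ 2 + ((H : ℝ) ^ 6 * s ^ 3) ^ 2 + ((H : ℝ) ^ 4 * s ^ 4) ^ 2 ≤ 4 * ρ ^ 2 := by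
    simpa only [Nat.mul_one, pow_one] using hRle 1
  have hR2 : ((H : ℝ) ^ 4 / β) ^ 2 + (β * (H : ℝ) ^ 4 * s ^ 5) ^ 4 + ((H : ℝ) ^ 6 * s ^ 3) ^ 4 + ((H : ℝ) ^ 4 * s ^ 4) ^ 4 ≤ 4 * (ρ ^ 2) ^ 2 := by
    simpa only [show 2 * 2 = 4 from rfl] using hRle 2
  have hR3 : ((H : ℝ) ^ 4 / β) ^ 3 + (β * (H : ℝ) ^ 4 * s ^ 5) ^ 6 + ((H : ℝ) ^ 6 * s ^ 3) ^ 6 + ((H : ℝ) ^ 4 * s ^ 4) ^ 6 ≤ 4 * (ρ ^ 2) ^ 3 := by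
    simpa only [show 2 * 3 = 6 from rfl] using hRle 3
  -- opaque names for the three brackets and their square roots
  obtain ⟨R₁, hR₁⟩ : ∃ R : ℝ, R = (H : ℝ) ^ 4 / β + (β * (H : ℝ) ^ 4 * s ^ 5) ^ 2 + ((H : ℝ) ^ 6 * s ^ 3) ^ 2 + ((H : ℝ) ^ 4 * s ^ 4) ^ 2 := ⟨_, rfl⟩
  obtain ⟨R₂, hR₂⟩ : ∃ R : ℝ, R = ((H : ℝ) ^ 4 / β) ^ 2 + (β * (H : ℝ) ^ 4 * s ^ 5) ^ 4 + ((H : ℝ) ^ 6 * s ^ 3) ^ 4 + ((H : ℝ) ^ 4 * s ^ 4) ^ 4 :=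
    ⟨_, rfl⟩
  obtain ⟨R₃, hR₃⟩ : ∃ R : ℝ, R = ((H : ℝ) ^ 4 / β) ^ 3 + (β * (H : ℝ) ^ 4 * s ^ 5) ^ 6 + ((H : ℝ) ^ 6 * s ^ 3) ^ 6 + ((H : ℝ) ^ 4 * s ^ 4) ^ 6 :=
    ⟨_, rfl⟩
  rw [← hR₁] at hR1
  rw [← hR₂] at hR2
  rw [← hR₃] at hR3
  rw [← hR₁, ← hR₂, ← hR₃] at hh
  have hR₁0 : 0 ≤ R₁ := by rw [hR₁]; positivity
  have hs1' : Real.sqrt R₁ ≤ 2 * ρ := Real.sqrt_le_iff.mpr ⟨by positivity, by nlinarith only [hR1]⟩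
  have hs2' : Real.sqrt R₂ ≤ 2 * ρ ^ 2 := Real.sqrt_le_iff.mpr ⟨by positivity, by nlinarith only [hR2]⟩
  have hs3' : Real.sqrt R₃ ≤ 2 * ρ ^ 3 := Real.sqrt_le_iff.mpr ⟨by positivity, by nlinarith only [hR3]⟩
  have hsum : Real.sqrt R₃ + Real.sqrt R₁ * Real.sqrt R₂ + R₁ * Real.sqrt R₁ ≤ 14 * ρ ^ 3 := by
    have p1 : Real.sqrt R₁ * Real.sqrt R₂ ≤ (2 * ρ) * (2 * ρ ^ 2) := mul_le_mul hs1' hs2' (Real.sqrt_nonneg _) (by positivity)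
    have p2 : R₁ * Real.sqrt R₁ ≤ (4 * ρ ^ 2) * (2 * ρ) := mul_le_mul hR1 hs1' (Real.sqrt_nonneg _) (by positivity)
    have e : (2 * ρ) * (2 * ρ ^ 2) = 4 * ρ ^ 3 := by ring
    have e' : (4 * ρ ^ 2) * (2 * ρ) = 8 * ρ ^ 3 := by ring
    rw [e] at p1
    rw [e'] at p2
    linarith only [p1, p2, hs3']
  have hpre : 0 ≤ C * (1 + Real.log (H : ℝ)) ^ m * ((1 + Real.log (H : ℝ)) ^ 2 / β ^ 2 + s ^ 3 / (β * Real.sqrt β)) := by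
    have := Real.log_nonneg hH1
    positivity
  calc |Tilt.tiltCum5 ((volume.restrict (smallField H s)).withDensity fun a => ENNReal.ofReal (gaussWeight β H a))
          (tiltU β H) t (chartPlaqCost H x 1 2) (chartPlaqCost H y 1 2)|
      ≤ C * (1 + Real.log (H : ℝ)) ^ m * (((1 + Real.log (H : ℝ)) ^ 2 / β ^ 2 + s ^ 3 / (β * Real.sqrt β)) *
          (Real.sqrt R₃ + Real.sqrt R₁ * Real.sqrt R₂ + R₁ * Real.sqrt R₁)) := hh
    _ = C * (1 + Real.log (H : ℝ)) ^ m * ((1 + Real.log (H : ℝ)) ^ 2 / β ^ 2 + s ^ 3 / (β * Real.sqrt β)) *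
          (Real.sqrt R₃ + Real.sqrt R₁ * Real.sqrt R₂ + R₁ * Real.sqrt R₁) := by ring
    _ ≤ C * (1 + Real.log (H : ℝ)) ^ m * ((1 + Real.log (H : ℝ)) ^ 2 / β ^ 2 + s ^ 3 / (β * Real.sqrt β)) * (14 * ρ ^ 3) :=
        mul_le_mul_of_nonneg_left hsum hpre
    _ = 14 * C * (1 + Real.log (H : ℝ)) ^ m * (((1 + Real.log (H : ℝ)) ^ 2 / β ^ 2 + s ^ 3 / (β * Real.sqrt β)) * ((H : ℝ) ^ 6 / (β * Real.sqrt β))) := by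
        rw [hρ3]; ring

end GaussNormalForm

end Summit.QuantumFields.YangMills.Theorems.AllWindowsColdBoxBoxHighLine

end
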